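import Literature.NumberTheory.EllipticCurves.BinaryQuarticMinimisationTwoProofs
import Literature.NumberTheory.EllipticCurves.BhargavaShankarTwoTorsionProofs
import HarnessLib

/-!
# Bhargava–Shankar, Theorem 1.1 and Cor. 1.2 (average rank `≤ 3/2`): the proved frontier —
# everything granted Lemma 5.2 (the `2`-covering correspondence) and eq. (31) (the count)

`Proofs` companion of `BSDWave0.lean` / `BhargavaShankarCounting.lean` /
`BinaryQuarticMinimisation.lean`. It joins the two proved halves of the tree's decomposition of
the named fact `Literature.NumberTheory.EllipticCurves.averageRankLE_three_halves` — M. Bhargava,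
A. Shankar, *Binary quartic forms having bounded invariants, and the boundedness of the average
rank of elliptic curves*, Ann. of Math. (2) 181 (2015) 191–242, **Cor. 1.2** (numbering of the
held arXiv text `arXiv:1006.1002v2`, whose §5 is §3 of the published version):

* `BinaryQuarticMinimisationTwoProofs` (with `…PrimeProofs`, `…ThreeProofs`): the three
  minimisation lemmas of [BSD] (Lemmas 5.3, 5.4, 5.5 of the held text) are theorems, so the
  `2`-Selmer parametrization **Theorem 5.6** (`bhargavaShankar_card_selmerTwo_eq`) holds granted
  only **Lemma 5.2** (`bhargavaShankar_card_selmerTwo_eq_kEquivClassCount`, the Birch–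
  Swinnerton-Dyer correspondence between `Sel^{(2)}(E/ℚ)` and the classes of locally soluble
  quartics with invariants `λ⁴I(E)`, `λ⁶J(E)`): `bhargavaShankar_card_selmerTwo_eq_of_bsd_correspondence`.
* `BhargavaShankarTwoTorsionProofs`: **Prop. 5.8** is a theorem
  (`bhargavaShankar_sum_card_selmerTwo_twoTorsion_le_holds`), so Theorem 1.1 and Cor. 1.2 hold
  granted Theorem 5.6 and **eq. (31)** (`bhargavaShankar_sum_irredClassCount_asymptotic`: the
  geometry-of-numbers count of §2 with Prop. 5.12, Prop. 5.13 and Lemma 5.16 of the held text):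
  `averageRankLE_three_halves_of_two_BS_facts`.

Composing the two: Theorem 1.1 (`average_card_selmerTwo`, and its `limsup` form
`heightAverageLE_card_selmerTwo`) and Cor. 1.2 (`averageRankLE_three_halves`) hold granted exactly
the two named facts Lemma 5.2 and eq. (31); every other step of the printed derivation (held text
pp. 3, 31–35: Thm 5.6 from Lemmas 5.2–5.5; Lemma 5.15; Props. 5.7, 5.8; Thm 1.1 from (30), (31),
Thm 5.6 and Props. 5.7–5.8; Cor. 1.2 from Thm 1.1 via `2^r ≤ #Sel^{(2)}` and `r ≤ (3/2)·… `) is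
proved in the tree. The two remaining inputs are the deep content of the paper and of [BSD]:
eq. (31) is §2 (Thms 2.1, 2.11, 2.21: reduction theory, averaging, cutting off the cusp, the
sieve) with §5.2–5.3; Lemma 5.2 is the identification of `H¹`-Selmer classes with locally soluble
`2`-coverings carrying a degree-`2` divisor (Cassels; [BSD] Lemmas 1–2).

## References

* M. Bhargava, A. Shankar, Ann. of Math. (2) 181 (2015) 191–242 = arXiv:1006.1002, Thm 1.1,
  Cor. 1.2, §5 (arXiv v2 numbering). [cite: BhargavaShankarAnnals2015, Cor. 1.2]
* B. J. Birch, H. P. F. Swinnerton-Dyer, *Notes on elliptic curves. I*, J. reine angew. Math.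
  212 (1963) 7–25, Lemmas 1–5.

## Design

No definitions; three one-line compositions of the two companion files' frontier theorems.
-/

noncomputable section

namespace Literature.NumberTheory.EllipticCurves

/-- **Bhargava–Shankar, Theorem 1.1, granted Lemma 5.2 and eq. (31) of the held arXiv text**
(Lemmas 5.3–5.5, Lemma 5.15, Props. 5.7–5.8 and the assembly being proved): the average size of
the `2`-Selmer group over the curves `E_{A,B}` of naive height `< X` tends to `3`
(`Literature.NumberTheory.EllipticCurves.average_card_selmerTwo`).
[cite: BhargavaShankarAnnals2015, Thm 1.1 (arXiv:1006.1002v2 numbering)] -/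
theorem average_card_selmerTwo_of_bsd_correspondence_of_count
    (h52 : bhargavaShankar_card_selmerTwo_eq_kEquivClassCount)
    (h31 : bhargavaShankar_sum_irredClassCount_asymptotic) :
    EllipticCurves.average_card_selmerTwo :=
  average_card_selmerTwo_of_two_BS_facts
    (bhargavaShankar_card_selmerTwo_eq_of_bsd_correspondence h52) h31

/-- **Bhargava–Shankar, Theorem 1.1 in `limsup` form, granted Lemma 5.2 and eq. (31)**
(`Literature.NumberTheory.EllipticCurves.heightAverageLE_card_selmerTwo`).
[cite: BhargavaShankarAnnals2015, Thm 1.1 (arXiv:1006.1002v2 numbering)] -/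
theorem heightAverageLE_card_selmerTwo_of_bsd_correspondence_of_count
    (h52 : bhargavaShankar_card_selmerTwo_eq_kEquivClassCount)
    (h31 : bhargavaShankar_sum_irredClassCount_asymptotic) :
    EllipticCurves.heightAverageLE_card_selmerTwo :=
  heightAverageLE_card_selmerTwo_of_two_BS_facts
    (bhargavaShankar_card_selmerTwo_eq_of_bsd_correspondence h52) h31

/-- **Bhargava–Shankar, Cor. 1.2 (average rank `≤ 3/2`,
`Literature.NumberTheory.EllipticCurves.averageRankLE_three_halves`), granted exactly the two
remaining printed inputs**: Lemma 5.2 (the Birch–Swinnerton-Dyer `2`-covering/Selmer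
correspondence, `bhargavaShankar_card_selmerTwo_eq_kEquivClassCount`) and eq. (31) (the
geometry-of-numbers count of locally soluble irreducible quartics, with Prop. 5.12 and
Lemma 5.16, `bhargavaShankar_sum_irredClassCount_asymptotic`) of the held arXiv text; all other
steps of the paper's derivation of Cor. 1.2 are theorems of the tree.
[cite: BhargavaShankarAnnals2015, Cor. 1.2] -/
theorem averageRankLE_three_halves_of_bsd_correspondence_of_count
    (h52 : bhargavaShankar_card_selmerTwo_eq_kEquivClassCount)
    (h31 : bhargavaShankar_sum_irredClassCount_asymptotic) :
    EllipticCurves.averageRankLE_three_halves :=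
  averageRankLE_three_halves_of_two_BS_facts
    (bhargavaShankar_card_selmerTwo_eq_of_bsd_correspondence h52) h31

end Literature.NumberTheory.EllipticCurves

end
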